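import Mathlib.Data.Nat.Choose.Central
import Summits.ValiantsHypothesis.ValiantsHypothesis.Theorems.KPlusLogSqLawTropicalBHalving

/-!
# Route `KPlusLogSqLaw`, crux `TropicalB` — ITERATED HALVING: the tropical row is at most exponential in `m` times
# linear in `K`: `T_D(m,K) + 1 ≤ 4^(m−1)·K`

HONEST FRAMING.  Helper file toward the registered stubs `stub_tropThin` / `stub_tropFat` of
`Cruxes/TropicalB/Lines/birth.lean` (crux `Summit.ValiantsHypothesis.ValiantsHypothesis.Theses.KPlusLogSqLaw.TropicalB`,
ledger item `stmt-ValiantsHypothesis-19771`, route `KPlusLogSqLaw`; cell `pub-symmetroid`, seat `val-sym-trop-p4` g6,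
2026-08-27).  Nothing here proves any part of a stub; nothing asserts `TropicalB`, `KPlusLogSqLaw`, `WeakLifting`,
`MatrixDescartes` or anything about `VP ≠ VNP`.  Everything below concerns the SUPER-FAT corner `K ≫ m` and the fixed-`m`
rows of the tropical census; inside the window `log₂ m + 1 < K < m` slope counting is better and nothing is claimed there.

WHAT IS PROVED.  Iterating the landed halving rung `tropRowD_halving`
(`TropRowD c K B₁ → TropRowD e K B₂ → TropRowD (c+e) K (C(c+e,c)·(B₁+B₂+1) − 1)`, p420925, the dominance form of the
upper half of Hrubeš–Yehudayoff 2021 Prop. 23) down to the one-entry row `tropRowD_one : TropRowD 1 K (K − 1)` along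
balanced splits `m = ⌊m/2⌋ + ⌈m/2⌉`, and closing the induction with the two central-binomial inequalities
`2·C(2a,a) ≤ 4^a` (`two_mul_centralBinom_le_four_pow`) and `5·C(2a+1,a) ≤ 4^(a+1)` (`five_mul_choose_le_four_pow`):

* **`tropRowD_four_pow : TropRowD m K (4^(m−1)·K − 1)`** for ALL `m, K` — an UNSIGNED dominant chain of a design of
  format `(m, K)` has fewer than `4^(m−1)·K` terms; signed form `tropRootLawAt_four_pow`.
* the EXACT halving rows (the recursion `h(1) = 1`, `h(a+e) = C(a+e,a)·(h(a)+h(e))` evaluated; all unsigned, hence signed):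
  `tropRowD_two_row : TropRowD 2 K (4K − 3)` · `tropRowD_three_row : TropRowD 3 K (15K − 10)` ·
  `tropRowD_four_row : TropRowD 4 K (48K − 31)` · `tropRowD_five_row : TropRowD 5 K (190K − 121)` ·
  `tropRowD_six_row : TropRowD 6 K (600K − 381)` · `tropRowD_seven_row : TropRowD 7 K (2205K − 1401)` ·
  `tropRowD_eight_row : TropRowD 8 K (6720K − 4271)`.

WHY IT IS WORTH RECORDING (comparison with the tree; arithmetic lemmas in §4).  The cell booked the halving rung as «worth
nothing inside the window» (true: at `m = cK` it costs `2c` bits per class against counting's `log₂(ec)`) and then bounded the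
super-fat corner by PERMUTATION counting, which produces FACTORIAL slopes in `K`: the thin law
`TropRootLawAt m K (m!·(m(K−1)+1) − 1)` (`tropRootLawAt_thin`, p406287), the half-thin law
`m! − 1 + (m!·m + m²)(K−1)/2` (`tropRootLawAt_halfThin`, p476649), the five-halves law `2(T+1) ≤ 2m! + 5m!(K−1)`
(p482166) and the one-revisit law `(1 + O(m^{−1/2}))·m!` per class for `m ≥ 16` (p484714).  The iterated halving slope is
`≤ 4^(m−1)`, which is SUB-FACTORIAL from `m = 7` on (`four_pow_pred_lt_factorial`), and the exact rows are below every
landed law already from `m = 4` (`48 < 56`, `190 < 300`, `600 < 1800`); the general law is below the thin law at every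
format with `m ≥ 5`, `K ≥ 2` (`four_pow_law_le_thin`; for `m = 3, 4` use the exact rows: `15K − 10 ≤ 18K − 13`,
`48K − 31 ≤ 96K − 73`).  Rows of record that move: the UNSIGNED `m = 3` row `T_D(3,K) ≤ 15K − 10` (the tree had the signed
`⌊(27K−17)/2⌋` and unsigned only via `tropRowD_of_tropRootLawAt`, factor two); the `m = 4` row `T(4,K) ≤ 48K − 31`,
below counting `C(K+3,4) − 1` from `K = 9` on (`row_four_below_counting_nine`: `401 < 494`) and below `56K − 33`
(half-thin) for every `K ≥ 1`; the rows `m = 5, …, 8` likewise.  READING (located, not a theorem about the limit): the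
super-fat slope `c_m := limsup_K T(m,K)/K` satisfies `c_m ≤ 4^(m−1)` — exponential, not factorial — against the cell's
all-`K` lower families `10K − 41` (`m = 3`, unsigned) and `13K − 53` (`m = 4`, unsigned); under the small side of
Hrubeš–Yehudayoff's Open Problem 1 one would have `c_m = m^{O(log m)}`.  [folklore; doi:10.4230/LIPIcs.CCC.2021.9 Prop. 23
for the shadow form of the halving step]
-/

set_option linter.dupNamespace false
set_option autoImplicit false

namespace Summit.ValiantsHypothesis.ValiantsHypothesis.Theorems.KPlusLogSqLaw

open Summit.ValiantsHypothesis.ValiantsHypothesis.Theorems.MatrixDescartes.Negative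
open Summit.ValiantsHypothesis.ValiantsHypothesis.Theorems.LacunarySymmetroidMatrixDescartes
open Summit.ValiantsHypothesis.ValiantsHypothesis.Theorems.LacunarySymmetroidMatrixDescartes.TropicalCensus

namespace IteratedHalving

/-! ## 1. Central-binomial arithmetic -/

/-- `C(2n+2, n+1) ≤ 4·C(2n, n)`. [folklore; from Mathlib's `Nat.succ_mul_centralBinom_succ`] -/
theorem centralBinom_succ_le_four_mul (n : ℕ) : Nat.centralBinom (n + 1) ≤ 4 * Nat.centralBinom n := by
  have h := Nat.succ_mul_centralBinom_succ n
  have h2 : (n + 1) * Nat.centralBinom (n + 1) ≤ (n + 1) * (4 * Nat.centralBinom n) := by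
    rw [h]; nlinarith [Nat.zero_le (Nat.centralBinom n)]
  exact Nat.le_of_mul_le_mul_left h2 (Nat.succ_pos n)

/-- `2·C(2n, n) ≤ 4^n` for `n ≥ 1` (the middle binomial coefficient is at most half of `2^{2n}`). [folklore] -/
theorem two_mul_centralBinom_le_four_pow (n : ℕ) (hn : 1 ≤ n) : 2 * Nat.centralBinom n ≤ 4 ^ n := by
  induction n with
  | zero => omega
  | succ n ih =>
    rcases Nat.eq_zero_or_pos n with rfl | hpos
    · decide
    · calc 2 * Nat.centralBinom (n + 1) ≤ 2 * (4 * Nat.centralBinom n) :=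
            Nat.mul_le_mul_left _ (centralBinom_succ_le_four_mul n)
        _ = 4 * (2 * Nat.centralBinom n) := by ring
        _ ≤ 4 * 4 ^ n := Nat.mul_le_mul_left _ (ih hpos)
        _ = 4 ^ (n + 1) := by ring

/-- `5·C(2n, n) ≤ 2·4^n` for `n ≥ 2`. [folklore] -/
theorem five_mul_centralBinom_le (n : ℕ) (hn : 2 ≤ n) : 5 * Nat.centralBinom n ≤ 2 * 4 ^ n := by
  induction n with
  | zero => omega
  | succ n ih =>
    rcases Nat.lt_or_ge n 2 with hlt | hge
    · interval_cases n
      · omega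
      · decide
    · calc 5 * Nat.centralBinom (n + 1) ≤ 5 * (4 * Nat.centralBinom n) :=
            Nat.mul_le_mul_left _ (centralBinom_succ_le_four_mul n)
        _ = 4 * (5 * Nat.centralBinom n) := by ring
        _ ≤ 4 * (2 * 4 ^ n) := Nat.mul_le_mul_left _ (ih hge)
        _ = 2 * 4 ^ (n + 1) := by ring

/-- `C(2a+2, a+1) = 2·C(2a+1, a)`. [folklore] -/
theorem centralBinom_succ_eq_two_mul_choose (a : ℕ) : Nat.centralBinom (a + 1) = 2 * (2 * a + 1).choose a := by
  rw [Nat.centralBinom_eq_two_mul_choose, show 2 * (a + 1) = (2 * a + 1) + 1 by ring, Nat.choose_succ_succ',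
    Nat.choose_symm_half]
  ring

/-- `5·C(2a+1, a) ≤ 4^(a+1)` for `a ≥ 1` — the odd case of the halving induction. [folklore] -/
theorem five_mul_choose_le_four_pow (a : ℕ) (ha : 1 ≤ a) : 5 * (2 * a + 1).choose a ≤ 4 ^ (a + 1) := by
  have h := five_mul_centralBinom_le (a + 1) (by omega)
  rw [centralBinom_succ_eq_two_mul_choose] at h
  omega

/-- `2·C(a+a, a) ≤ 4^a` for `a ≥ 1` — the even case of the halving induction. [folklore] -/
theorem two_mul_choose_self_add_le_four_pow (a : ℕ) (ha : 1 ≤ a) : 2 * (a + a).choose a ≤ 4 ^ a := by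
  have h := two_mul_centralBinom_le_four_pow a ha
  rw [← two_mul]
  rwa [Nat.centralBinom_eq_two_mul_choose] at h

/-- the subtraction bookkeeping of one halving step: if `C·(X + Y) ≤ T` with `X, Y ≥ 1` then
`C·((X − 1) + (Y − 1) + 1) − 1 ≤ T − 1`. [arithmetic] -/
theorem halving_arith {C X Y T : ℕ} (hX : 1 ≤ X) (hY : 1 ≤ Y) (h : C * (X + Y) ≤ T) :
    C * (X - 1 + (Y - 1) + 1) - 1 ≤ T - 1 := by
  have h1 : X - 1 + (Y - 1) + 1 ≤ X + Y := by omega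
  exact Nat.sub_le_sub_right ((Nat.mul_le_mul_left _ h1).trans h) 1

/-! ## 2. The iterated halving law -/

/-- **ITERATED HALVING LAW** (unsigned): `TropRowD m K (4^(m−1)·K − 1)` for all `m, K` — an unsigned dominant chain of a
design of format `(m, K)` has fewer than `4^(m−1)·K` terms.  Balanced halving `m = ⌊m/2⌋ + ⌈m/2⌉` by
`tropRowD_halving` down to `tropRowD_one`, closed by `2·C(2a,a) ≤ 4^a` and `5·C(2a+1,a) ≤ 4^(a+1)`.
[folklore: iterate doi:10.4230/LIPIcs.CCC.2021.9 Prop. 23 in the dominance vocabulary] -/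
theorem tropRowD_four_pow (m K : ℕ) : TropRowD m K (4 ^ (m - 1) * K - 1) := by
  rcases Nat.eq_zero_or_pos K with rfl | hK
  · exact tropRowD_zero m _
  induction m using Nat.strong_induction_on with
  | _ m ih =>
    rcases Nat.eq_zero_or_pos m with rfl | hmpos
    · exact tropRowD_size_zero K _
    obtain ⟨a, rfl | rfl⟩ := Nat.even_or_odd' m
    · -- even `m = 2a`, `a ≥ 1`
      have ha : 1 ≤ a := by omega
      have h₁ := ih a (by omega)
      have hh := tropRowD_halving h₁ h₁
      rw [two_mul]
      refine tropRowD_mono ?_ hh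
      have hX : 1 ≤ 4 ^ (a - 1) * K := Nat.mul_pos (Nat.one_le_pow _ _ (by norm_num)) hK
      refine halving_arith hX hX ?_
      have key : (a + a).choose a * (4 ^ (a - 1) + 4 ^ (a - 1)) ≤ 4 ^ (a + a - 1) := by
        have e1 : 4 ^ (a + a - 1) = 4 ^ a * 4 ^ (a - 1) := by
          rw [← pow_add]; congr 1; omega
        rw [e1]
        calc (a + a).choose a * (4 ^ (a - 1) + 4 ^ (a - 1)) = 2 * (a + a).choose a * 4 ^ (a - 1) := by ring
          _ ≤ 4 ^ a * 4 ^ (a - 1) := Nat.mul_le_mul_right _ (two_mul_choose_self_add_le_four_pow a ha)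
      calc (a + a).choose a * (4 ^ (a - 1) * K + 4 ^ (a - 1) * K)
          = (a + a).choose a * (4 ^ (a - 1) + 4 ^ (a - 1)) * K := by ring
        _ ≤ 4 ^ (a + a - 1) * K := Nat.mul_le_mul_right _ key
    · -- odd `m = 2a + 1`
      rcases Nat.eq_zero_or_pos a with rfl | ha
      · -- `m = 1`
        simpa using tropRowD_one K
      have h₁ := ih a (by omega)
      have h₂ := ih (a + 1) (by omega)
      have hh := tropRowD_halving h₁ h₂
      rw [show 2 * a + 1 = a + (a + 1) by ring]
      refine tropRowD_mono ?_ hh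
      have hX : 1 ≤ 4 ^ (a - 1) * K := Nat.mul_pos (Nat.one_le_pow _ _ (by norm_num)) hK
      have hY : 1 ≤ 4 ^ (a + 1 - 1) * K := Nat.mul_pos (Nat.one_le_pow _ _ (by norm_num)) hK
      refine halving_arith hX hY ?_
      have key : (a + (a + 1)).choose a * (4 ^ (a - 1) + 4 ^ (a + 1 - 1)) ≤ 4 ^ (a + (a + 1) - 1) := by
        have e1 : 4 ^ (a + (a + 1) - 1) = 4 ^ (a + 1) * 4 ^ (a - 1) := by
          rw [← pow_add]; congr 1; omega
        have e2 : 4 ^ (a + 1 - 1) = 4 * 4 ^ (a - 1) := by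
          rw [← pow_succ']; congr 1; omega
        have e3 : a + (a + 1) = 2 * a + 1 := by ring
        rw [e1, e2, e3]
        calc (2 * a + 1).choose a * (4 ^ (a - 1) + 4 * 4 ^ (a - 1))
            = 5 * (2 * a + 1).choose a * 4 ^ (a - 1) := by ring
          _ ≤ 4 ^ (a + 1) * 4 ^ (a - 1) := Nat.mul_le_mul_right _ (five_mul_choose_le_four_pow a ha)
      calc (a + (a + 1)).choose a * (4 ^ (a - 1) * K + 4 ^ (a + 1 - 1) * K)
          = (a + (a + 1)).choose a * (4 ^ (a - 1) + 4 ^ (a + 1 - 1)) * K := by ring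
        _ ≤ 4 ^ (a + (a + 1) - 1) * K := Nat.mul_le_mul_right _ key

/-- **ITERATED HALVING LAW** (signed row): `TropRootLawAt m K (4^(m−1)·K − 1)` for all `m, K`. [folklore] -/
theorem tropRootLawAt_four_pow (m K : ℕ) : TropRootLawAt m K (4 ^ (m - 1) * K - 1) :=
  tropRootLawAt_of_tropRowD (tropRowD_four_pow m K)

/-! ## 3. The exact halving rows `m = 2, …, 8` -/

/-- `T_D(2,K) ≤ 4K − 3` (halving of two one-entry rows; the tree's signed `tropRootLawAt_two`, unsigned). [folklore] -/
theorem tropRowD_two_row (K : ℕ) : TropRowD 2 K (4 * K - 3) := by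
  rcases Nat.eq_zero_or_pos K with rfl | hK
  · exact tropRowD_zero 2 _
  have h := tropRowD_halving (tropRowD_one K) (tropRowD_one K)
  have hc : (1 + 1).choose 1 = 2 := by decide
  rw [hc] at h
  exact tropRowD_mono (by omega) h

/-- **`T_D(3,K) ≤ 15K − 10`** (unsigned `m = 3` row; halving `3 = 1 + 2`). [folklore] -/
theorem tropRowD_three_row (K : ℕ) : TropRowD 3 K (15 * K - 10) := by
  rcases Nat.eq_zero_or_pos K with rfl | hK
  · exact tropRowD_zero 3 _
  have h := tropRowD_halving (tropRowD_one K) (tropRowD_two_row K)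
  have hc : (1 + 2).choose 1 = 3 := by decide
  rw [hc] at h
  exact tropRowD_mono (by omega) h

/-- **`T_D(4,K) ≤ 48K − 31`** (halving `4 = 2 + 2`). [folklore] -/
theorem tropRowD_four_row (K : ℕ) : TropRowD 4 K (48 * K - 31) := by
  rcases Nat.eq_zero_or_pos K with rfl | hK
  · exact tropRowD_zero 4 _
  have h := tropRowD_halving (tropRowD_two_row K) (tropRowD_two_row K)
  have hc : (2 + 2).choose 2 = 6 := by decide
  rw [hc] at h
  exact tropRowD_mono (by omega) h

/-- **`T_D(5,K) ≤ 190K − 121`** (halving `5 = 2 + 3`). [folklore] -/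
theorem tropRowD_five_row (K : ℕ) : TropRowD 5 K (190 * K - 121) := by
  rcases Nat.eq_zero_or_pos K with rfl | hK
  · exact tropRowD_zero 5 _
  have h := tropRowD_halving (tropRowD_two_row K) (tropRowD_three_row K)
  have hc : (2 + 3).choose 2 = 10 := by decide
  rw [hc] at h
  exact tropRowD_mono (by omega) h

/-- **`T_D(6,K) ≤ 600K − 381`** (halving `6 = 3 + 3`). [folklore] -/
theorem tropRowD_six_row (K : ℕ) : TropRowD 6 K (600 * K - 381) := by
  rcases Nat.eq_zero_or_pos K with rfl | hK
  · exact tropRowD_zero 6 _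
  have h := tropRowD_halving (tropRowD_three_row K) (tropRowD_three_row K)
  have hc : (3 + 3).choose 3 = 20 := by decide
  rw [hc] at h
  exact tropRowD_mono (by omega) h

/-- **`T_D(7,K) ≤ 2205K − 1401`** (halving `7 = 3 + 4`). [folklore] -/
theorem tropRowD_seven_row (K : ℕ) : TropRowD 7 K (2205 * K - 1401) := by
  rcases Nat.eq_zero_or_pos K with rfl | hK
  · exact tropRowD_zero 7 _
  have h := tropRowD_halving (tropRowD_three_row K) (tropRowD_four_row K)
  have hc : (3 + 4).choose 3 = 35 := by decide
  rw [hc] at h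
  exact tropRowD_mono (by omega) h

/-- **`T_D(8,K) ≤ 6720K − 4271`** (halving `8 = 4 + 4`). [folklore] -/
theorem tropRowD_eight_row (K : ℕ) : TropRowD 8 K (6720 * K - 4271) := by
  rcases Nat.eq_zero_or_pos K with rfl | hK
  · exact tropRowD_zero 8 _
  have h := tropRowD_halving (tropRowD_four_row K) (tropRowD_four_row K)
  have hc : (4 + 4).choose 4 = 70 := by decide
  rw [hc] at h
  exact tropRowD_mono (by omega) h

/-- the signed `m = 3` halving row. [folklore] -/
theorem tropRootLawAt_three_row (K : ℕ) : TropRootLawAt 3 K (15 * K - 10) :=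
  tropRootLawAt_of_tropRowD (tropRowD_three_row K)

/-- **the signed `m = 4` row `T(4,K) ≤ 48K − 31`.** [folklore] -/
theorem tropRootLawAt_four_row (K : ℕ) : TropRootLawAt 4 K (48 * K - 31) :=
  tropRootLawAt_of_tropRowD (tropRowD_four_row K)

/-- the signed `m = 5` row `T(5,K) ≤ 190K − 121`. [folklore] -/
theorem tropRootLawAt_five_row (K : ℕ) : TropRootLawAt 5 K (190 * K - 121) :=
  tropRootLawAt_of_tropRowD (tropRowD_five_row K)

/-- the signed `m = 6` row `T(6,K) ≤ 600K − 381`. [folklore] -/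
theorem tropRootLawAt_six_row (K : ℕ) : TropRootLawAt 6 K (600 * K - 381) :=
  tropRootLawAt_of_tropRowD (tropRowD_six_row K)

/-! ## 4. Comparison with the tree's laws (arithmetic only; the named laws are cited, not imported) -/

/-- the halving slope is sub-factorial from `m = 7` on: `4^(m−1) < m!` (`4096 < 5040` and `4 < m + 1` thereafter) — so
`tropRootLawAt_four_pow` is below every law of factorial slope (thin / half-thin / five-halves / one-revisit) for all large
`K`. [arithmetic] -/
theorem four_pow_pred_lt_factorial {m : ℕ} (hm : 7 ≤ m) : 4 ^ (m - 1) < m.factorial := by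
  induction m with
  | zero => omega
  | succ n ih =>
    rcases Nat.lt_or_ge n 7 with hlt | hge
    · have : n = 6 := by omega
      subst this; decide
    · have h1 := ih hge
      rw [Nat.factorial_succ, show n + 1 - 1 = (n - 1) + 1 by omega, pow_succ]
      calc 4 ^ (n - 1) * 4 < n.factorial * 4 := Nat.mul_lt_mul_of_pos_right h1 (by norm_num)
        _ ≤ (n + 1) * n.factorial := by rw [mul_comm]; exact Nat.mul_le_mul_right _ (by omega)

/-- `2·4^(m−1) ≤ m!·m` for `m ≥ 5`. [arithmetic] -/
theorem two_mul_four_pow_le_factorial_mul {m : ℕ} (hm : 5 ≤ m) : 2 * 4 ^ (m - 1) ≤ m.factorial * m := by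
  induction m with
  | zero => omega
  | succ n ih =>
    rcases Nat.lt_or_ge n 5 with hlt | hge
    · have : n = 4 := by omega
      subst this; decide
    · have h1 := ih hge
      rw [Nat.factorial_succ, show n + 1 - 1 = (n - 1) + 1 by omega, pow_succ]
      have h4 : 4 * n ≤ (n + 1) * (n + 1) := by nlinarith
      calc 2 * (4 ^ (n - 1) * 4) = 4 * (2 * 4 ^ (n - 1)) := by ring
        _ ≤ 4 * (n.factorial * n) := Nat.mul_le_mul_left _ h1
        _ = n.factorial * (4 * n) := by ring
        _ ≤ n.factorial * ((n + 1) * (n + 1)) := Nat.mul_le_mul_left _ h4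
        _ = (n + 1) * n.factorial * (n + 1) := by ring

/-- **below the thin law**: for `m ≥ 5` and `K ≥ 2` the iterated halving bound `4^(m−1)·K − 1` is at most the thin law
`m!·(m(K−1)+1) − 1` of `tropRootLawAt_thin` (p406287); for `m = 3, 4` see `three_row_le_thin` / `four_row_le_thin`.
[arithmetic] -/
theorem four_pow_law_le_thin {m K : ℕ} (hm : 5 ≤ m) (hK : 2 ≤ K) :
    4 ^ (m - 1) * K - 1 ≤ m.factorial * (m * (K - 1) + 1) - 1 := by
  refine Nat.sub_le_sub_right ?_ 1
  have h := two_mul_four_pow_le_factorial_mul hm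
  have hK2 : K ≤ 2 * (K - 1) := by omega
  calc 4 ^ (m - 1) * K ≤ 4 ^ (m - 1) * (2 * (K - 1)) := Nat.mul_le_mul_left _ hK2
    _ = 2 * 4 ^ (m - 1) * (K - 1) := by ring
    _ ≤ m.factorial * m * (K - 1) := Nat.mul_le_mul_right _ h
    _ = m.factorial * (m * (K - 1)) := by ring
    _ ≤ m.factorial * (m * (K - 1) + 1) := Nat.mul_le_mul_left _ (Nat.le_succ _)

/-- `m = 3`: `15K − 10 ≤ 3!·(3(K−1)+1) − 1 = 18K − 13` for `K ≥ 1` (thin law, p406287). [arithmetic] -/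
theorem three_row_le_thin {K : ℕ} (hK : 1 ≤ K) : 15 * K - 10 ≤ Nat.factorial 3 * (3 * (K - 1) + 1) - 1 := by
  rw [show Nat.factorial 3 = 6 by decide]; omega

/-- `m = 4`: `48K − 31 ≤ 4!·(4(K−1)+1) − 1 = 96K − 73` for `K ≥ 1` (thin law, p406287). [arithmetic] -/
theorem four_row_le_thin {K : ℕ} (hK : 1 ≤ K) : 48 * K - 31 ≤ Nat.factorial 4 * (4 * (K - 1) + 1) - 1 := by
  rw [show Nat.factorial 4 = 24 by decide]; omega

/-- `m = 4`: `48K − 31 ≤ 4! − 1 + 56(K−1) = 56K − 33`, the `m = 4` instance of the half-thin law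
`m! − 1 + (m!·m + m²)(K−1)/2` (`tropRootLawAt_halfThin`, p476649). [arithmetic] -/
theorem four_row_le_halfThin (K : ℕ) :
    48 * K - 31 ≤ Nat.factorial 4 - 1 + (Nat.factorial 4 * 4 + 4 ^ 2) * (K - 1) / 2 := by
  rw [show Nat.factorial 4 = 24 by decide]; omega

/-- `m = 5`: `190K − 121 ≤ 5! − 1 + (5!·5 + 25)(K−1)/2`, the `m = 5` instance of the half-thin law (p476649), and
`2·(190K − 121 + 1) ≤ 2·5! + 5·5!·(K−1)`, the `m = 5` instance of the five-halves law (p482166). [arithmetic] -/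
theorem five_row_le_halfThin_and_fiveHalves (K : ℕ) :
    190 * K - 121 ≤ Nat.factorial 5 - 1 + (Nat.factorial 5 * 5 + 5 ^ 2) * (K - 1) / 2 ∧
      2 * (190 * K - 121 + 1) ≤ 2 * Nat.factorial 5 + 5 * Nat.factorial 5 * (K - 1) := by
  rw [show Nat.factorial 5 = 120 by decide]; omega

/-- the `m = 4` halving row passes BELOW slope counting `C(K+3,4) − 1` at `K = 9`: `48·9 − 31 = 401 < 494 = C(12,4) − 1`
(and stays below for larger `K`, the left side being linear and the right side quartic). [arithmetic] -/
theorem row_four_below_counting_nine : 48 * 9 - 31 < Nat.choose (9 + 3) 4 - 1 := by decide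

/-- the `m = 3` halving row against slope counting `C(K+2,3) − 1`: counting is still better at `K = 7`
(`C(9,3) − 1 = 83 < 95 = 15·7 − 10`) and the halving row is better from `K = 8` on (`110 < 119 = C(10,3) − 1`; the left
side is linear, the right side cubic).  Recorded as the two instances. [arithmetic] -/
theorem row_three_vs_counting : Nat.choose (7 + 2) 3 - 1 < 15 * 7 - 10 ∧ 15 * 8 - 10 < Nat.choose (8 + 2) 3 - 1 := by
  decide

end IteratedHalving

end Summit.ValiantsHypothesis.ValiantsHypothesis.Theorems.KPlusLogSqLaw
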